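import Summits.ValiantsHypothesis.ValiantsHypothesis.Theses.LacunarySymmetroid

/-!
# `MatrixDescartes` — negative lemma: the symmetry hypothesis is not load-bearing

Crux `stmt-ValiantsHypothesis-18050` (`Theses.LacunarySymmetroid.MatrixDescartes`, MDR) quantifies over
real SYMMETRIC coefficient matrices `Sₗ`.  This file shows that hypothesis carries no information: MDR
implies the same statement for ARBITRARY real square coefficients (`MatrixDescartesGeneral`), by the
symmetric doubling `T ↦ [[0, P], [Pᵀ, 1]]` (`P = ∑ₗ X^{dₗ} Tₗ`; one extra constant term `[[0,0],[0,1]]`,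
size `2m`, `det = (−1)^m (det P)²`, identical real zero SET), at the cost `(c, q) ↦ (c+1, 2q)` in the
quantifier prefix (`matrixDescartesGeneral_of_matrixDescartes`).  Consequences for both sides:

* a PROOF of MDR may not use symmetry/self-adjointness in any essential way (eigenvalue branches,
  interlacing, Loewner order are conveniences, not leverage): it must bound the real zeros of every
  quasi-polynomial-size determinant — equivalently every algebraic branching program — over `K`
  lacunary monomials;
* a REFUTATION may be sought among general (e.g. Hessenberg/ABP, triangular-class) pencils; no
  symmetric realisation step is ever needed.

[folklore] Symmetric doubling of determinantal representations (e.g. Grenet–Kaltofen–Koiran–Portier,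
arXiv:1007.3804 §2); here with the `1`-block so that `Matrix.det_fromBlocks_one₂₂` applies verbatim.
-/

-- `Summit.ValiantsHypothesis.ValiantsHypothesis.…` repeats a component by the D-0017 layout
-- (single-conjunct summit), which the `dupNamespace` linter flags; the name is mandated.
set_option linter.dupNamespace false

namespace Summit.ValiantsHypothesis.ValiantsHypothesis.Theorems.MatrixDescartes.Negative

open Summit.ValiantsHypothesis.ValiantsHypothesis.Theses.LacunarySymmetroid
open scoped BigOperators Matrix
open Polynomial

/-- MDR for GENERAL (not necessarily symmetric) real lacunary pencils, same quantifier shape and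
same bound as the crux. -/
def MatrixDescartesGeneral : Prop :=
  ∀ c q : ℕ, 0 < q → ∃ K₀ : ℕ, ∀ K m : ℕ, K₀ ≤ K → m ≤ 2 ^ ((Nat.log 2 K + c) ^ c) →
    ∀ (d : Fin K → ℕ) (T : Fin K → Matrix (Fin m) (Fin m) ℝ),
      (Matrix.det (∑ l, ((Polynomial.X : Polynomial ℝ) ^ d l) • (T l).map Polynomial.C)
        ).roots.toFinset.card ^ q ≤ 2 ^ (K * Nat.log 2 K)

/-- The converse direction is trivial: general pencils include the symmetric ones. -/
theorem matrixDescartes_of_matrixDescartesGeneral (h : MatrixDescartesGeneral) : MatrixDescartes := by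
  intro c q hq
  obtain ⟨K₀, hK⟩ := h c q hq
  exact ⟨K₀, fun K m hKm hm d S _ => hK K m hKm hm d S⟩

section Doubling

variable {m K : ℕ}

/-- exponents of the symmetric doubling: `0, d₀, …, d_{K-1}` -/
def dD (d : Fin K → ℕ) : Fin (K + 1) → ℕ :=
  Fin.cons 0 d

/-- block coefficients of the doubling on `Fin m ⊕ Fin m`: `[[0,0],[0,1]]`, then `[[0,Tₗ],[Tₗᵀ,0]]` -/
def BD (T : Fin K → Matrix (Fin m) (Fin m) ℝ) :
    Fin (K + 1) → Matrix (Fin m ⊕ Fin m) (Fin m ⊕ Fin m) ℝ :=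
  Fin.cons (Matrix.fromBlocks 0 0 0 1) fun l => Matrix.fromBlocks 0 (T l) (T l)ᵀ 0

/-- the doubled coefficients, reindexed to `Fin (m + m)` (the crux's index type) -/
def SD (T : Fin K → Matrix (Fin m) (Fin m) ℝ) :
    Fin (K + 1) → Matrix (Fin (m + m)) (Fin (m + m)) ℝ :=
  fun l => Matrix.reindex finSumFinEquiv finSumFinEquiv (BD T l)

/-- the block coefficients are symmetric -/
theorem BD_isSymm (T : Fin K → Matrix (Fin m) (Fin m) ℝ) (l : Fin (K + 1)) : (BD T l).IsSymm := by
  refine Fin.cases ?_ (fun l => ?_) l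
  · simp only [BD, Fin.cons_zero]
    unfold Matrix.IsSymm
    rw [Matrix.fromBlocks_transpose]
    simp
  · simp only [BD, Fin.cons_succ]
    unfold Matrix.IsSymm
    rw [Matrix.fromBlocks_transpose]
    simp

/-- the doubled coefficients are symmetric -/
theorem SD_isSymm (T : Fin K → Matrix (Fin m) (Fin m) ℝ) (l : Fin (K + 1)) : (SD T l).IsSymm := by
  unfold SD Matrix.IsSymm
  rw [Matrix.transpose_reindex, (BD_isSymm T l).eq]

/-- the doubled pencil on `Fin m ⊕ Fin m` is `[[0, P], [Pᵀ, 1]]` -/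
theorem pencil_BD (d : Fin K → ℕ) (T : Fin K → Matrix (Fin m) (Fin m) ℝ) :
    (∑ l, (X : ℝ[X]) ^ dD d l • (BD T l).map Polynomial.C) =
      Matrix.fromBlocks 0 (∑ l, (X : ℝ[X]) ^ d l • (T l).map Polynomial.C)
        (∑ l, (X : ℝ[X]) ^ d l • (T l).map Polynomial.C)ᵀ 1 := by
  ext (i | i) (j | j)
  · simp [dD, BD, Fin.sum_univ_succ, Matrix.sum_apply]
  · simp [dD, BD, Fin.sum_univ_succ, Matrix.sum_apply]
  · simp [dD, BD, Fin.sum_univ_succ, Matrix.sum_apply]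
  · simp [dD, BD, Fin.sum_univ_succ, Matrix.sum_apply, Matrix.one_apply, apply_ite Polynomial.C]

/-- the doubled pencil on `Fin (m+m)` is the reindexing of the block pencil -/
theorem pencil_SD (d : Fin K → ℕ) (T : Fin K → Matrix (Fin m) (Fin m) ℝ) :
    (∑ l, (X : ℝ[X]) ^ dD d l • (SD T l).map Polynomial.C) =
      Matrix.reindex finSumFinEquiv finSumFinEquiv
        (∑ l, (X : ℝ[X]) ^ dD d l • (BD T l).map Polynomial.C) := by
  ext i j
  simp [SD, Matrix.sum_apply]

/-- `det` of the doubling is `(−1)^m (det P)²` -/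
theorem det_pencil_SD (d : Fin K → ℕ) (T : Fin K → Matrix (Fin m) (Fin m) ℝ) :
    (∑ l, (X : ℝ[X]) ^ dD d l • (SD T l).map Polynomial.C).det =
      Polynomial.C ((-1 : ℝ) ^ m) * (∑ l, (X : ℝ[X]) ^ d l • (T l).map Polynomial.C).det ^ 2 := by
  rw [pencil_SD, Matrix.det_reindex_self, pencil_BD, Matrix.det_fromBlocks_one₂₂, zero_sub,
    Matrix.det_neg, Matrix.det_mul, Matrix.det_transpose, Fintype.card_fin, map_pow, map_neg, map_one]
  ring

/-- the doubling has exactly the same distinct real zeros -/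
theorem card_roots_SD (d : Fin K → ℕ) (T : Fin K → Matrix (Fin m) (Fin m) ℝ) :
    (∑ l, (X : ℝ[X]) ^ dD d l • (SD T l).map Polynomial.C).det.roots.toFinset.card =
      (∑ l, (X : ℝ[X]) ^ d l • (T l).map Polynomial.C).det.roots.toFinset.card := by
  rw [det_pencil_SD, Polynomial.roots_C_mul _ (pow_ne_zero _ (by norm_num)), Polynomial.roots_pow,
    Multiset.toFinset_nsmul _ _ two_ne_zero]

end Doubling

/-- size bookkeeping of the doubling: `(L+c)^c + 1 ≤ (L₁+c+1)^(c+1)` whenever `2 ≤ L ≤ L₁`. -/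
theorem pow_succ_bookkeeping (L L₁ c : ℕ) (hL : 2 ≤ L) (hLL : L ≤ L₁) :
    (L + c) ^ c + 1 ≤ (L₁ + (c + 1)) ^ (c + 1) := by
  have h1 : (L + c) ^ c ≤ (L₁ + (c + 1)) ^ c := Nat.pow_le_pow_left (by omega) c
  have h2 : 1 ≤ (L₁ + (c + 1)) ^ c := Nat.one_le_pow _ _ (by omega)
  have h3 : 2 ≤ L₁ + (c + 1) := by omega
  calc (L + c) ^ c + 1 ≤ (L₁ + (c + 1)) ^ c + (L₁ + (c + 1)) ^ c := Nat.add_le_add h1 h2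
    _ = (L₁ + (c + 1)) ^ c * 2 := by ring
    _ ≤ (L₁ + (c + 1)) ^ c * (L₁ + (c + 1)) := Nat.mul_le_mul_left _ h3
    _ = (L₁ + (c + 1)) ^ (c + 1) := by rw [pow_succ]

/-- **Symmetry is not load-bearing**: MDR (symmetric coefficients) implies MDR for arbitrary real
square coefficients, via the doubling `[[0,P],[Pᵀ,1]]` with `(c, q) ↦ (c+1, 2q)`. [folklore] -/
theorem matrixDescartesGeneral_of_matrixDescartes (h : MatrixDescartes) : MatrixDescartesGeneral := by
  intro c q hq
  obtain ⟨K₀, hK⟩ := h (c + 1) (2 * q) (by omega)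
  refine ⟨max K₀ 4, fun K m hKm hm d T => ?_⟩
  have hK4 : 4 ≤ K := le_of_max_le_right hKm
  have hK₀ : K₀ ≤ K + 1 := by
    have := le_of_max_le_left hKm
    omega
  have hL2 : 2 ≤ Nat.log 2 K :=
    calc 2 = Nat.log 2 4 := by decide
      _ ≤ Nat.log 2 K := Nat.log_mono_right hK4
  have hLle : Nat.log 2 K ≤ Nat.log 2 (K + 1) := Nat.log_mono_right (Nat.le_succ K)
  have hL' : Nat.log 2 (K + 1) ≤ Nat.log 2 K + 1 :=
    calc Nat.log 2 (K + 1) ≤ Nat.log 2 (K * 2) := Nat.log_mono_right (by omega)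
      _ = Nat.log 2 K + 1 := Nat.log_mul_base (by norm_num) (by omega)
  have hsize : m + m ≤ 2 ^ ((Nat.log 2 (K + 1) + (c + 1)) ^ (c + 1)) :=
    calc m + m ≤ 2 ^ ((Nat.log 2 K + c) ^ c) + 2 ^ ((Nat.log 2 K + c) ^ c) := Nat.add_le_add hm hm
      _ = 2 ^ ((Nat.log 2 K + c) ^ c + 1) := by rw [pow_succ]; ring
      _ ≤ 2 ^ ((Nat.log 2 (K + 1) + (c + 1)) ^ (c + 1)) :=
          Nat.pow_le_pow_right (by norm_num) (pow_succ_bookkeeping _ _ c hL2 hLle)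
  have h1 := hK (K + 1) (m + m) hK₀ hsize (dD d) (SD T) (SD_isSymm T)
  rw [card_roots_SD] at h1
  have h2 : (K + 1) * Nat.log 2 (K + 1) ≤ 2 * (K * Nat.log 2 K) := by
    calc (K + 1) * Nat.log 2 (K + 1) ≤ (K + 1) * (Nat.log 2 K + 1) := Nat.mul_le_mul_left _ hL'
      _ ≤ 2 * (K * Nat.log 2 K) := by nlinarith
  have h3 : ((∑ l, (X : ℝ[X]) ^ d l • (T l).map Polynomial.C).det.roots.toFinset.card ^ q) ^ 2
      ≤ (2 ^ (K * Nat.log 2 K)) ^ 2 :=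
    calc ((∑ l, (X : ℝ[X]) ^ d l • (T l).map Polynomial.C).det.roots.toFinset.card ^ q) ^ 2
          = (∑ l, (X : ℝ[X]) ^ d l • (T l).map Polynomial.C).det.roots.toFinset.card ^ (2 * q) := by
            rw [← pow_mul, mul_comm]
      _ ≤ 2 ^ ((K + 1) * Nat.log 2 (K + 1)) := h1
      _ ≤ 2 ^ (2 * (K * Nat.log 2 K)) := Nat.pow_le_pow_right (by norm_num) h2
      _ = (2 ^ (K * Nat.log 2 K)) ^ 2 := by rw [← pow_mul, mul_comm]
  exact (Nat.pow_le_pow_iff_left two_ne_zero).1 h3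

/-- MDR and its symmetry-free form are EQUIVALENT. -/
theorem matrixDescartes_iff_general : MatrixDescartes ↔ MatrixDescartesGeneral :=
  ⟨matrixDescartesGeneral_of_matrixDescartes, matrixDescartes_of_matrixDescartesGeneral⟩

end Summit.ValiantsHypothesis.ValiantsHypothesis.Theorems.MatrixDescartes.Negative
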